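import Literature.MathematicalPhysics.QuantumLattice.LatticeGaugeDLRGibbsProofs
import Literature.MathematicalPhysics.QuantumFieldTheory.Sweep1ShenZhuZhuProofs
import HarnessLib

/-!
# Venture YMGap, track ROBUST-BALL — «C-DS-II» (door level): MIXED BOUNDARY DIFFERENCES OF THE FINITE-VOLUME FREE ENERGY ARE
# KERNEL COVARIANCES — the Dobrushin–Shlosman complete-analyticity Condition II/IIIb shape, reduced to kernel clustering

HONEST FRAMING. WHAT THIS IS: a venture file (cell `pub-ymgap`, track Y2 ROBUST-BALL / DS, seat ds-3, theorems only, 0 compute), the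
DOOR of the object «C-DS-II»; the `SU(2)` cells (kernel clustering of `KernelClusteringBall` / `StarKernelClusteringZd`) are separate files.
Setting: any compact metrisable gauge group `G`, continuous `ρ`, any `d`, any real coupling `b`, a FINITE link volume `Λ`, a boundary field
`η` and modifications `η₁` (off a link set `B₁` equal to `η`), `η₂` (off `B₂` equal to `η`), `η₁₂` (`= η₁` on `B₁`, `= η₂` on `B₂`, `= η`
elsewhere); `Z_Λ(b|·) = ∫ exp(−b S_Λ(ζ ⊕ ·_{Λᶜ})) ∏_{e∈Λ} dζ_e` the normaliser of the Wilson DLR kernel `γ_Λ(·|·)` (tree `ymSpecification`).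
* `normaliser_eq_normaliser_mul_integral` — `Z_Λ(b|η') = Z_Λ(b|η) · γ_Λ^η[exp(−b ΔS_{η→η'})]`, `ΔS_{η→η'}(U) = S_Λ(U_Λ ⊕ η') − S_Λ(U_Λ ⊕ η)`
  (a cylinder function of the links IN `Λ`); `log_normaliser_sub_eq_log_integral`;
* `boundaryShift_add` — if no plaquette touching `Λ` has links in both `B₁` and `B₂`, then `ΔS_{η→η₁₂} = ΔS_{η→η₁} + ΔS_{η→η₂}`;
* `abs_log_integral_mul_sub_le` — for positive observables `A ∈ [e^{−a}, e^{a}]`, `B ∈ [e^{−a'}, e^{a'}]` of a probability measure: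
  `|log ∫AB − log ∫A − log ∫B| ≤ e^{a+a'} · |cov(A, B)|`;
* ★★ `abs_mixedDifference_log_normaliser_le` — THE DOOR: `|log Z_Λ(η₁₂) − log Z_Λ(η₁) − log Z_Λ(η₂) + log Z_Λ(η)| ≤ e^{|b|(D₁+D₂)} · ε`
  whenever `|ΔS_{η→ηᵢ}| ≤ Dᵢ` and `|cov_{γ_Λ(·|η)}(exp(−bΔS₁), exp(−bΔS₂))| ≤ ε`: the MIXED second difference of the free energy in the
  boundary field IS a kernel covariance of two boundary factors — so every kernel-clustering theorem uniform in `(Λ, η)` (the seat's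
  «C-KMIX» rows) turns into the Dobrushin–Shlosman Condition-II shape with the SAME rate;
The `SU(N)` currency of the boundary factors (bounded by `e^{2N|b|·#P'}`, Lipschitz cylinders on the links of the plaquettes `P'` touching the
modification set, constant `|b| e^{2N|b|#P'} · 8N⁴ · #P'`) is the sequel `BoundaryFactorLipschitz.lean`; the `SU(2)` cells follow it.
WHAT THIS IS NOT: no clustering is proved here (door only); real couplings; nothing about the continuum limit or Clay.
References: R. L. Dobrushin, S. B. Shlosman, *Completely analytical interactions: constructive description*, J. Stat. Phys. 46 (1987),
Conditions II–III (statement shape only); everything here is proved. [folklore]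
-/

noncomputable section

open MeasureTheory ProbabilityTheory Filter Topology Real Finset Set
open scoped NNReal
open Literature.Probability.LatticeModels hiding configShift configShift_apply
open Literature.MathematicalPhysics.QuantumLattice
open Literature.MathematicalPhysics.QuantumFieldTheory (IsLipschitzCylinder isLipschitzCylinder_zdPlaquetteObs zdPlaquetteObs
  haarProbability card_plaquetteEdges_le suEntries)

namespace Summit.Ventures.YMGap.RobustBall

namespace BoundaryFreeEnergy

/-! ### Part A — generic identities: ratios of normalisers are kernel expectations of boundary factors -/

section Generic

variable {d N : ℕ} {G : Type*} [Group G] [TopologicalSpace G] [IsTopologicalGroup G] [CompactSpace G]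
  [MeasurableSpace G] [BorelSpace G] [SecondCountableTopology G] (ρ : G →* Matrix (Fin N) (Fin N) ℂ)

omit [Group G] [TopologicalSpace G] [IsTopologicalGroup G] [CompactSpace G] [MeasurableSpace G] [BorelSpace G]
  [SecondCountableTopology G] in
/-- Re-gluing a glued configuration: `(ζ ⊕ η)_Λ ⊕ η' = ζ ⊕ η'`. [folklore] -/
theorem glueWith_restrict_glueWith (Λ : Finset (ZdEdge d)) (ζ : ↥Λ → G) (η η' : LGConfig d G) :
    glueWith Λ (fun e : ↥Λ => glueWith Λ ζ η e) η' = glueWith Λ ζ η' := by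
  funext e
  by_cases he : e ∈ Λ
  · rw [glueWith_apply_mem _ _ _ he, glueWith_apply_mem _ _ _ he]
    exact (glueWith_apply_mem _ _ _ he).symm
  · rw [glueWith_apply_not_mem _ _ _ he, glueWith_apply_not_mem _ _ _ he]

/-- **Ratio of normalisers = kernel expectation of the boundary factor**: for every finite `Λ`, coupling `b` and boundary fields `η, η'`,
`Z_Λ(b|η') = Z_Λ(b|η) · ∫ exp(−b (S_Λ(U_Λ ⊕ η') − S_Λ(U_Λ ⊕ η))) dγ_Λ^b(U|η)`. [folklore] -/
theorem normaliser_eq_normaliser_mul_integral (hρ : Continuous ρ) (b : ℝ) (Λ : Finset (ZdEdge d)) (η η' : LGConfig d G) :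
    (∫ ζ, Real.exp (-b * wilsonBoundaryAction ρ Λ (glueWith Λ ζ η')) ∂(Measure.pi fun _ : ↥Λ => haarProbability G)) =
      (∫ ζ, Real.exp (-b * wilsonBoundaryAction ρ Λ (glueWith Λ ζ η)) ∂(Measure.pi fun _ : ↥Λ => haarProbability G)) *
        ∫ U, Real.exp (-b * (wilsonBoundaryAction ρ Λ (glueWith Λ (fun e : ↥Λ => U e) η') -
          wilsonBoundaryAction ρ Λ (glueWith Λ (fun e : ↥Λ => U e) η))) ∂(ymSpecification ρ b Λ η) := by
  have hS : Continuous (wilsonBoundaryAction (G := G) ρ Λ) := continuous_wilsonBoundaryAction ρ hρ Λ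
  have hR : ∀ ω : LGConfig d G, Measurable fun U : LGConfig d G => glueWith Λ (fun e : ↥Λ => U e) ω := fun ω =>
    Measurable.comp (g := fun ζ : ↥Λ → G => glueWith Λ ζ ω) (f := fun U : LGConfig d G => fun e : ↥Λ => U e)
      (measurable_glueWith Λ ω) (measurable_pi_lambda _ fun e => measurable_pi_apply (e : ZdEdge d))
  have hF : Measurable fun U : LGConfig d G => Real.exp (-b * (wilsonBoundaryAction ρ Λ (glueWith Λ (fun e : ↥Λ => U e) η') -
      wilsonBoundaryAction ρ Λ (glueWith Λ (fun e : ↥Λ => U e) η))) :=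
    (Real.measurable_exp.comp (((hS.measurable.comp (hR η')).sub (hS.measurable.comp (hR η))).const_mul _))
  rw [integral_ymSpecification ρ hρ b Λ hF η]
  have hZ := normaliser_pos ρ hρ b Λ η
  rw [← mul_div_assoc, mul_div_cancel_left₀ _ hZ.ne']
  refine integral_congr_ae (ae_of_all _ fun ζ => ?_)
  dsimp only
  rw [glueWith_restrict_glueWith, glueWith_restrict_glueWith, ← Real.exp_add]
  congr 1; ring

/-- **Difference of free energies = log of a kernel expectation**:
`log Z_Λ(b|η') − log Z_Λ(b|η) = log ∫ exp(−b ΔS_{η→η'}) dγ_Λ^b(·|η)`. [folklore] -/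
theorem log_normaliser_sub_eq_log_integral (hρ : Continuous ρ) (b : ℝ) (Λ : Finset (ZdEdge d)) (η η' : LGConfig d G) :
    Real.log (∫ ζ, Real.exp (-b * wilsonBoundaryAction ρ Λ (glueWith Λ ζ η')) ∂(Measure.pi fun _ : ↥Λ => haarProbability G)) -
        Real.log (∫ ζ, Real.exp (-b * wilsonBoundaryAction ρ Λ (glueWith Λ ζ η)) ∂(Measure.pi fun _ : ↥Λ => haarProbability G)) =
      Real.log (∫ U, Real.exp (-b * (wilsonBoundaryAction ρ Λ (glueWith Λ (fun e : ↥Λ => U e) η') -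
          wilsonBoundaryAction ρ Λ (glueWith Λ (fun e : ↥Λ => U e) η))) ∂(ymSpecification ρ b Λ η)) := by
  have hZ := normaliser_pos ρ hρ b Λ η
  have hZ' := normaliser_pos ρ hρ b Λ η'
  rw [normaliser_eq_normaliser_mul_integral ρ hρ b Λ η η'] at hZ' ⊢
  have hI : 0 < ∫ U, Real.exp (-b * (wilsonBoundaryAction ρ Λ (glueWith Λ (fun e : ↥Λ => U e) η') -
      wilsonBoundaryAction ρ Λ (glueWith Λ (fun e : ↥Λ => U e) η))) ∂(ymSpecification ρ b Λ η) :=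
    pos_of_mul_pos_right hZ' hZ.le
  rw [Real.log_mul hZ.ne' hI.ne']
  ring

omit [TopologicalSpace G] [IsTopologicalGroup G] [CompactSpace G] [MeasurableSpace G] [BorelSpace G] [SecondCountableTopology G] in
/-- **Locality of the boundary shift**: only the plaquettes touching `Λ` with a link where `η' ≠ η` contribute to `ΔS_{η→η'}`:
`S_Λ(ζ ⊕ η') − S_Λ(ζ ⊕ η) = Σ_{p ∈ T(Λ), p ∩ B ≠ ∅} (Re tr ρ(U_p)(ζ ⊕ η) − Re tr ρ(U_p)(ζ ⊕ η'))` whenever `η' = η` off `B`. [folklore] -/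
theorem boundaryShift_eq_sum_filter [DecidableEq (ZdEdge d)] (Λ B : Finset (ZdEdge d)) {η η' : LGConfig d G}
    (hη' : ∀ e, e ∉ B → η' e = η e) (ζ : ↥Λ → G) :
    wilsonBoundaryAction ρ Λ (glueWith Λ ζ η') - wilsonBoundaryAction ρ Λ (glueWith Λ ζ η) =
      ∑ p ∈ (plaquettesTouching Λ).filter (fun p => (plaquetteEdges p ∩ B).Nonempty),
        (plaquetteObs ρ p.1 p.2.1.1 p.2.1.2 (glueWith Λ ζ η) - plaquetteObs ρ p.1 p.2.1.1 p.2.1.2 (glueWith Λ ζ η')) := by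
  unfold wilsonBoundaryAction
  rw [← Finset.sum_sub_distrib, ← Finset.sum_filter_add_sum_filter_not (plaquettesTouching Λ)
    (fun p => (plaquetteEdges p ∩ B).Nonempty)]
  have hzero : ∑ p ∈ (plaquettesTouching Λ).filter (fun p => ¬(plaquetteEdges p ∩ B).Nonempty),
      (((N : ℝ) - plaquetteObs ρ p.1 p.2.1.1 p.2.1.2 (glueWith Λ ζ η')) -
        ((N : ℝ) - plaquetteObs ρ p.1 p.2.1.1 p.2.1.2 (glueWith Λ ζ η))) = 0 := by
    refine Finset.sum_eq_zero fun p hp => ?_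
    have hp' := (Finset.mem_filter.1 hp).2
    have hagree : ∀ e ∈ plaquetteEdges p, glueWith Λ ζ η' e = glueWith Λ ζ η e := by
      intro e he
      by_cases heΛ : e ∈ Λ
      · rw [glueWith_apply_mem _ _ _ heΛ, glueWith_apply_mem _ _ _ heΛ]
      · rw [glueWith_apply_not_mem _ _ _ heΛ, glueWith_apply_not_mem _ _ _ heΛ]
        refine hη' e fun heB => hp' ⟨e, Finset.mem_inter.2 ⟨he, heB⟩⟩
    have hW : plaquetteObs ρ p.1 p.2.1.1 p.2.1.2 (glueWith Λ ζ η') = plaquetteObs ρ p.1 p.2.1.1 p.2.1.2 (glueWith Λ ζ η) :=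
      isCylinder_plaquetteObs ρ p hagree
    rw [hW, sub_self]
  rw [hzero, add_zero]
  refine Finset.sum_congr rfl fun p _ => by ring

omit [TopologicalSpace G] [IsTopologicalGroup G] [CompactSpace G] [MeasurableSpace G] [BorelSpace G] [SecondCountableTopology G] in
/-- **Additivity of separated boundary shifts.** If `η₁ = η` off `B₁`, `η₂ = η` off `B₂`, `η₁₂ = η₁` on `B₁`, `= η₂` on `B₂` and `= η` off
`B₁ ∪ B₂`, and no plaquette touching `Λ` has links in both `B₁` and `B₂`, then `ΔS_{η→η₁₂} = ΔS_{η→η₁} + ΔS_{η→η₂}`. [folklore] -/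
theorem boundaryShift_add [DecidableEq (ZdEdge d)] (Λ B₁ B₂ : Finset (ZdEdge d)) {η η₁ η₂ η₁₂ : LGConfig d G}
    (hη₁ : ∀ e, e ∉ B₁ → η₁ e = η e) (hη₂ : ∀ e, e ∉ B₂ → η₂ e = η e)
    (h₁₂B₁ : ∀ e ∈ B₁, η₁₂ e = η₁ e) (h₁₂B₂ : ∀ e ∈ B₂, η₁₂ e = η₂ e) (h₁₂ : ∀ e, e ∉ B₁ → e ∉ B₂ → η₁₂ e = η e)
    (hsep : ∀ p ∈ plaquettesTouching Λ, (plaquetteEdges p ∩ B₁).Nonempty → ¬(plaquetteEdges p ∩ B₂).Nonempty) (ζ : ↥Λ → G) :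
    wilsonBoundaryAction ρ Λ (glueWith Λ ζ η₁₂) - wilsonBoundaryAction ρ Λ (glueWith Λ ζ η) =
      (wilsonBoundaryAction ρ Λ (glueWith Λ ζ η₁) - wilsonBoundaryAction ρ Λ (glueWith Λ ζ η)) +
        (wilsonBoundaryAction ρ Λ (glueWith Λ ζ η₂) - wilsonBoundaryAction ρ Λ (glueWith Λ ζ η)) := by
  -- all three shifts as sums over the plaquettes touching `B₁ ∪ B₂`
  have hη₁' : ∀ e, e ∉ B₁ ∪ B₂ → η₁ e = η e := fun e he => hη₁ e fun h => he (Finset.mem_union_left _ h)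
  have hη₂' : ∀ e, e ∉ B₁ ∪ B₂ → η₂ e = η e := fun e he => hη₂ e fun h => he (Finset.mem_union_right _ h)
  have hη₁₂' : ∀ e, e ∉ B₁ ∪ B₂ → η₁₂ e = η e := fun e he =>
    h₁₂ e (fun h => he (Finset.mem_union_left _ h)) (fun h => he (Finset.mem_union_right _ h))
  rw [boundaryShift_eq_sum_filter ρ Λ (B₁ ∪ B₂) hη₁₂' ζ, boundaryShift_eq_sum_filter ρ Λ (B₁ ∪ B₂) hη₁' ζ,
    boundaryShift_eq_sum_filter ρ Λ (B₁ ∪ B₂) hη₂' ζ, ← Finset.sum_add_distrib]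
  refine Finset.sum_congr rfl fun p hp => ?_
  obtain ⟨hpT, hpB⟩ := Finset.mem_filter.1 hp
  -- `p` touches exactly one of `B₁`, `B₂`
  by_cases h1 : (plaquetteEdges p ∩ B₁).Nonempty
  · have h2 : ¬(plaquetteEdges p ∩ B₂).Nonempty := hsep p hpT h1
    -- on the links of `p`: `η₁₂ = η₁` and `η₂ = η`
    have hA : ∀ e ∈ plaquetteEdges p, glueWith Λ ζ η₁₂ e = glueWith Λ ζ η₁ e := by
      intro e he
      by_cases heΛ : e ∈ Λ
      · rw [glueWith_apply_mem _ _ _ heΛ, glueWith_apply_mem _ _ _ heΛ]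
      · rw [glueWith_apply_not_mem _ _ _ heΛ, glueWith_apply_not_mem _ _ _ heΛ]
        by_cases heB₁ : e ∈ B₁
        · exact h₁₂B₁ e heB₁
        · have heB₂ : e ∉ B₂ := fun heB₂ => h2 ⟨e, Finset.mem_inter.2 ⟨he, heB₂⟩⟩
          rw [h₁₂ e heB₁ heB₂, hη₁ e heB₁]
    have hB : ∀ e ∈ plaquetteEdges p, glueWith Λ ζ η₂ e = glueWith Λ ζ η e := by
      intro e he
      by_cases heΛ : e ∈ Λ
      · rw [glueWith_apply_mem _ _ _ heΛ, glueWith_apply_mem _ _ _ heΛ]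
      · rw [glueWith_apply_not_mem _ _ _ heΛ, glueWith_apply_not_mem _ _ _ heΛ]
        exact hη₂ e fun heB₂ => h2 ⟨e, Finset.mem_inter.2 ⟨he, heB₂⟩⟩
    rw [isCylinder_plaquetteObs ρ p hA, isCylinder_plaquetteObs ρ p hB]
    ring
  · -- then `p` touches `B₂` (it touches `B₁ ∪ B₂`)
    have hA : ∀ e ∈ plaquetteEdges p, glueWith Λ ζ η₁₂ e = glueWith Λ ζ η₂ e := by
      intro e he
      by_cases heΛ : e ∈ Λ
      · rw [glueWith_apply_mem _ _ _ heΛ, glueWith_apply_mem _ _ _ heΛ]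
      · rw [glueWith_apply_not_mem _ _ _ heΛ, glueWith_apply_not_mem _ _ _ heΛ]
        have heB₁ : e ∉ B₁ := fun heB₁ => h1 ⟨e, Finset.mem_inter.2 ⟨he, heB₁⟩⟩
        by_cases heB₂ : e ∈ B₂
        · exact h₁₂B₂ e heB₂
        · rw [h₁₂ e heB₁ heB₂, hη₂ e heB₂]
    have hB : ∀ e ∈ plaquetteEdges p, glueWith Λ ζ η₁ e = glueWith Λ ζ η e := by
      intro e he
      by_cases heΛ : e ∈ Λ
      · rw [glueWith_apply_mem _ _ _ heΛ, glueWith_apply_mem _ _ _ heΛ]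
      · rw [glueWith_apply_not_mem _ _ _ heΛ, glueWith_apply_not_mem _ _ _ heΛ]
        exact hη₁ e fun heB₁ => h1 ⟨e, Finset.mem_inter.2 ⟨he, heB₁⟩⟩
    rw [isCylinder_plaquetteObs ρ p hA, isCylinder_plaquetteObs ρ p hB]
    ring

end Generic

/-! ### Part B — the abstract logarithmic lemma and the door -/

section Door

variable {Ω : Type*} [MeasurableSpace Ω]

/-- **The abstract logarithmic lemma.** For a probability measure `μ` and measurable observables `A ∈ [e^{−a}, e^{a}]`, `B ∈ [e^{−a'}, e^{a'}]`:
`|log ∫AB dμ − log ∫A dμ − log ∫B dμ| ≤ e^{a+a'} · |cov_μ(A, B)|`. [folklore] -/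
theorem abs_log_integral_mul_sub_le {μ : Measure Ω} [IsProbabilityMeasure μ] {A B : Ω → ℝ} {a a' : ℝ}
    (hAm : Measurable A) (hBm : Measurable B)
    (hA : ∀ ω, Real.exp (-a) ≤ A ω ∧ A ω ≤ Real.exp a) (hB : ∀ ω, Real.exp (-a') ≤ B ω ∧ B ω ≤ Real.exp a') :
    |Real.log (∫ ω, A ω * B ω ∂μ) - Real.log (∫ ω, A ω ∂μ) - Real.log (∫ ω, B ω ∂μ)| ≤
      Real.exp (a + a') * |cov[A, B; μ]| := by
  have hea : 0 < Real.exp (-a) := Real.exp_pos _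
  have hea' : 0 < Real.exp (-a') := Real.exp_pos _
  have hEa : 0 < Real.exp a := Real.exp_pos _
  have hEa' : 0 < Real.exp a' := Real.exp_pos _
  have hAb : ∀ ω, |A ω| ≤ Real.exp a := fun ω => abs_le.2 ⟨by linarith [(hA ω).1, hea, hEa], (hA ω).2⟩
  have hBb : ∀ ω, |B ω| ≤ Real.exp a' := fun ω => abs_le.2 ⟨by linarith [(hB ω).1, hea', hEa'], (hB ω).2⟩
  have hAi : Integrable A μ := integrable_of_bound hAm.aestronglyMeasurable hAb
  have hBi : Integrable B μ := integrable_of_bound hBm.aestronglyMeasurable hBb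
  have hABi : Integrable (fun ω => A ω * B ω) μ :=
    integrable_of_bound (hAm.mul hBm).aestronglyMeasurable (C := Real.exp a * Real.exp a') fun ω => by
      rw [abs_mul]; exact mul_le_mul (hAb ω) (hBb ω) (abs_nonneg _) (Real.exp_pos _).le
  -- lower bounds on the three integrals
  have hIA : Real.exp (-a) ≤ ∫ ω, A ω ∂μ := by
    have h := integral_mono (integrable_const (Real.exp (-a))) hAi fun ω => (hA ω).1
    simpa using h
  have hIB : Real.exp (-a') ≤ ∫ ω, B ω ∂μ := by
    have h := integral_mono (integrable_const (Real.exp (-a'))) hBi fun ω => (hB ω).1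
    simpa using h
  have hIAB : Real.exp (-a) * Real.exp (-a') ≤ ∫ ω, A ω * B ω ∂μ := by
    have h := integral_mono (integrable_const (Real.exp (-a) * Real.exp (-a'))) hABi fun ω =>
      mul_le_mul (hA ω).1 (hB ω).1 hea'.le (hea.le.trans (hA ω).1)
    simpa using h
  have hprod : Real.exp (-a) * Real.exp (-a') ≤ (∫ ω, A ω ∂μ) * ∫ ω, B ω ∂μ :=
    mul_le_mul hIA hIB hea'.le (hea.le.trans hIA)
  have hlow : 0 < Real.exp (-a) * Real.exp (-a') := mul_pos hea hea'
  have hx : 0 < ∫ ω, A ω * B ω ∂μ := hlow.trans_le hIAB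
  have hyA : 0 < ∫ ω, A ω ∂μ := hea.trans_le hIA
  have hyB : 0 < ∫ ω, B ω ∂μ := hea'.trans_le hIB
  have hy : 0 < (∫ ω, A ω ∂μ) * ∫ ω, B ω ∂μ := mul_pos hyA hyB
  -- the covariance identity
  have hcov : cov[A, B; μ] = (∫ ω, A ω * B ω ∂μ) - (∫ ω, A ω ∂μ) * ∫ ω, B ω ∂μ := by
    rw [covariance_eq_sub (MemLp.of_bound hAm.aestronglyMeasurable (Real.exp a) (ae_of_all _ fun ω => by
        rw [Real.norm_eq_abs]; exact hAb ω))
      (MemLp.of_bound hBm.aestronglyMeasurable (Real.exp a') (ae_of_all _ fun ω => by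
        rw [Real.norm_eq_abs]; exact hBb ω))]
    rfl
  have hmin : Real.exp (-a) * Real.exp (-a') ≤ min (∫ ω, A ω * B ω ∂μ) ((∫ ω, A ω ∂μ) * ∫ ω, B ω ∂μ) := le_min hIAB hprod
  -- `|log x − log y| ≤ |x − y| / min x y` for positive reals (from `log t ≤ t − 1`)
  have key : |Real.log (∫ ω, A ω * B ω ∂μ) - Real.log ((∫ ω, A ω ∂μ) * ∫ ω, B ω ∂μ)| ≤
      |(∫ ω, A ω * B ω ∂μ) - (∫ ω, A ω ∂μ) * ∫ ω, B ω ∂μ| / min (∫ ω, A ω * B ω ∂μ) ((∫ ω, A ω ∂μ) * ∫ ω, B ω ∂μ) := by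
    generalize (∫ ω, A ω * B ω ∂μ) = x at hx ⊢
    generalize ((∫ ω, A ω ∂μ) * ∫ ω, B ω ∂μ) = y at hy ⊢
    have hm : 0 < min x y := lt_min hx hy
    have hlog : ∀ {u v : ℝ}, 0 < u → 0 < v → Real.log u - Real.log v ≤ (u - v) / v := fun {u v} hu hv => by
      have h := Real.log_le_sub_one_of_pos (div_pos hu hv)
      rw [Real.log_div hu.ne' hv.ne'] at h
      have : u / v - 1 = (u - v) / v := by field_simp
      linarith
    rw [abs_le]
    constructor
    · have h1 := hlog hy hx
      have h2 : (y - x) / x ≤ |x - y| / min x y := by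
        calc (y - x) / x ≤ |x - y| / x := by gcongr; rw [abs_sub_comm]; exact le_abs_self _
          _ ≤ |x - y| / min x y := by gcongr; exact min_le_left _ _
      linarith
    · calc Real.log x - Real.log y ≤ (x - y) / y := hlog hx hy
        _ ≤ |x - y| / y := by gcongr; exact le_abs_self _
        _ ≤ |x - y| / min x y := by gcongr; exact min_le_right _ _
  rw [Real.log_mul hyA.ne' hyB.ne'] at key
  calc |Real.log (∫ ω, A ω * B ω ∂μ) - Real.log (∫ ω, A ω ∂μ) - Real.log (∫ ω, B ω ∂μ)|
      = |Real.log (∫ ω, A ω * B ω ∂μ) - (Real.log (∫ ω, A ω ∂μ) + Real.log (∫ ω, B ω ∂μ))| := by ring_nf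
    _ ≤ |(∫ ω, A ω * B ω ∂μ) - (∫ ω, A ω ∂μ) * ∫ ω, B ω ∂μ| / min (∫ ω, A ω * B ω ∂μ) ((∫ ω, A ω ∂μ) * ∫ ω, B ω ∂μ) := key
    _ ≤ |cov[A, B; μ]| / (Real.exp (-a) * Real.exp (-a')) := by
        rw [hcov]; exact div_le_div_of_nonneg_left (abs_nonneg _) hlow hmin
    _ = Real.exp (a + a') * |cov[A, B; μ]| := by
        rw [← Real.exp_add, show -a + -a' = -(a + a') by ring, Real.exp_neg, div_inv_eq_mul, mul_comm]

variable {d N : ℕ} {G : Type*} [Group G] [TopologicalSpace G] [IsTopologicalGroup G] [CompactSpace G]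
  [MeasurableSpace G] [BorelSpace G] [SecondCountableTopology G] (ρ : G →* Matrix (Fin N) (Fin N) ℂ)

/-- ★★ **THE DOOR OF «C-DS-II»: the mixed second difference of the free energy in the boundary field is a kernel covariance of two
boundary factors.** Any compact metrisable `G`, continuous `ρ`, any `d`, any real `b`, any finite `Λ`; boundary fields `η`, `η₁ = η` off `B₁`,
`η₂ = η` off `B₂`, `η₁₂` (`= η₁` on `B₁`, `= η₂` on `B₂`, `= η` elsewhere), no plaquette touching `Λ` meeting both `B₁` and `B₂`; if the boundary
shifts are bounded by `D₁, D₂` and the kernel covariance of the two boundary factors `exp(−bΔS_{η→ηᵢ})` is `≤ ε` in absolute value, then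
`|log Z_Λ(b|η₁₂) − log Z_Λ(b|η₁) − log Z_Λ(b|η₂) + log Z_Λ(b|η)| ≤ e^{|b|(D₁+D₂)} · ε`. [folklore] -/
theorem abs_mixedDifference_log_normaliser_le [DecidableEq (ZdEdge d)] (hρ : Continuous ρ) (b : ℝ) (Λ B₁ B₂ : Finset (ZdEdge d))
    {η η₁ η₂ η₁₂ : LGConfig d G}
    (hη₁ : ∀ e, e ∉ B₁ → η₁ e = η e) (hη₂ : ∀ e, e ∉ B₂ → η₂ e = η e)
    (h₁₂B₁ : ∀ e ∈ B₁, η₁₂ e = η₁ e) (h₁₂B₂ : ∀ e ∈ B₂, η₁₂ e = η₂ e) (h₁₂ : ∀ e, e ∉ B₁ → e ∉ B₂ → η₁₂ e = η e)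
    (hsep : ∀ p ∈ plaquettesTouching Λ, (plaquetteEdges p ∩ B₁).Nonempty → ¬(plaquetteEdges p ∩ B₂).Nonempty)
    {D₁ D₂ ε : ℝ}
    (hD₁ : ∀ ζ : ↥Λ → G, |wilsonBoundaryAction ρ Λ (glueWith Λ ζ η₁) - wilsonBoundaryAction ρ Λ (glueWith Λ ζ η)| ≤ D₁)
    (hD₂ : ∀ ζ : ↥Λ → G, |wilsonBoundaryAction ρ Λ (glueWith Λ ζ η₂) - wilsonBoundaryAction ρ Λ (glueWith Λ ζ η)| ≤ D₂)
    (hcov : |cov[fun U : LGConfig d G => Real.exp (-b * (wilsonBoundaryAction ρ Λ (glueWith Λ (fun e : ↥Λ => U e) η₁) -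
          wilsonBoundaryAction ρ Λ (glueWith Λ (fun e : ↥Λ => U e) η))),
        fun U : LGConfig d G => Real.exp (-b * (wilsonBoundaryAction ρ Λ (glueWith Λ (fun e : ↥Λ => U e) η₂) -
          wilsonBoundaryAction ρ Λ (glueWith Λ (fun e : ↥Λ => U e) η))); ymSpecification ρ b Λ η]| ≤ ε) :
    |Real.log (∫ ζ, Real.exp (-b * wilsonBoundaryAction ρ Λ (glueWith Λ ζ η₁₂)) ∂(Measure.pi fun _ : ↥Λ => haarProbability G)) -
        Real.log (∫ ζ, Real.exp (-b * wilsonBoundaryAction ρ Λ (glueWith Λ ζ η₁)) ∂(Measure.pi fun _ : ↥Λ => haarProbability G)) -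
        Real.log (∫ ζ, Real.exp (-b * wilsonBoundaryAction ρ Λ (glueWith Λ ζ η₂)) ∂(Measure.pi fun _ : ↥Λ => haarProbability G)) +
        Real.log (∫ ζ, Real.exp (-b * wilsonBoundaryAction ρ Λ (glueWith Λ ζ η)) ∂(Measure.pi fun _ : ↥Λ => haarProbability G))| ≤
      Real.exp (|b| * (D₁ + D₂)) * ε := by
  haveI := isProbabilityMeasure_ymSpecification ρ hρ b Λ η
  -- notation: the three boundary factors as functions of `U` through `U_Λ`
  set S : LGConfig d G → ℝ := wilsonBoundaryAction ρ Λ with hSdef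
  set F₁ : LGConfig d G → ℝ := fun U => Real.exp (-b * (S (glueWith Λ (fun e : ↥Λ => U e) η₁) - S (glueWith Λ (fun e : ↥Λ => U e) η)))
    with hF₁
  set F₂ : LGConfig d G → ℝ := fun U => Real.exp (-b * (S (glueWith Λ (fun e : ↥Λ => U e) η₂) - S (glueWith Λ (fun e : ↥Λ => U e) η)))
    with hF₂
  set F₁₂ : LGConfig d G → ℝ := fun U => Real.exp (-b * (S (glueWith Λ (fun e : ↥Λ => U e) η₁₂) - S (glueWith Λ (fun e : ↥Λ => U e) η)))
    with hF₁₂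
  have hS : Continuous S := continuous_wilsonBoundaryAction ρ hρ Λ
  have hR : ∀ ω : LGConfig d G, Measurable fun U : LGConfig d G => glueWith Λ (fun e : ↥Λ => U e) ω := fun ω =>
    Measurable.comp (g := fun ζ : ↥Λ → G => glueWith Λ ζ ω) (f := fun U : LGConfig d G => fun e : ↥Λ => U e)
      (measurable_glueWith Λ ω) (measurable_pi_lambda _ fun e => measurable_pi_apply (e : ZdEdge d))
  have hmeas : ∀ ω : LGConfig d G, Measurable fun U : LGConfig d G =>
      Real.exp (-b * (S (glueWith Λ (fun e : ↥Λ => U e) ω) - S (glueWith Λ (fun e : ↥Λ => U e) η))) := fun ω =>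
    Real.measurable_exp.comp (((hS.measurable.comp (hR ω)).sub (hS.measurable.comp (hR η))).const_mul _)
  -- the product structure of the double modification
  have hprod : ∀ U, F₁₂ U = F₁ U * F₂ U := fun U => by
    simp only [hF₁₂, hF₁, hF₂, ← Real.exp_add]
    congr 1
    rw [boundaryShift_add ρ Λ B₁ B₂ hη₁ hη₂ h₁₂B₁ h₁₂B₂ h₁₂ hsep]
    ring
  -- the three log-differences as logs of kernel expectations
  have hL₁ := log_normaliser_sub_eq_log_integral ρ hρ b Λ η η₁
  have hL₂ := log_normaliser_sub_eq_log_integral ρ hρ b Λ η η₂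
  have hL₁₂ := log_normaliser_sub_eq_log_integral ρ hρ b Λ η η₁₂
  -- bounds on the boundary factors
  have hbd : ∀ (ω : LGConfig d G) (D : ℝ), (∀ ζ : ↥Λ → G, |S (glueWith Λ ζ ω) - S (glueWith Λ ζ η)| ≤ D) →
      ∀ U : LGConfig d G, Real.exp (-(|b| * D)) ≤ Real.exp (-b * (S (glueWith Λ (fun e : ↥Λ => U e) ω) -
        S (glueWith Λ (fun e : ↥Λ => U e) η))) ∧
        Real.exp (-b * (S (glueWith Λ (fun e : ↥Λ => U e) ω) - S (glueWith Λ (fun e : ↥Λ => U e) η))) ≤ Real.exp (|b| * D) := by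
    intro ω D hD U
    have h := hD (fun e : ↥Λ => U e)
    have hx : |-b * (S (glueWith Λ (fun e : ↥Λ => U e) ω) - S (glueWith Λ (fun e : ↥Λ => U e) η))| ≤ |b| * D := by
      rw [abs_mul, abs_neg]; exact mul_le_mul_of_nonneg_left h (abs_nonneg b)
    constructor
    · exact Real.exp_le_exp.2 (by linarith [neg_abs_le (-b * (S (glueWith Λ (fun e : ↥Λ => U e) ω) -
        S (glueWith Λ (fun e : ↥Λ => U e) η)))])
    · exact Real.exp_le_exp.2 ((le_abs_self _).trans hx)
  have key := abs_log_integral_mul_sub_le (μ := ymSpecification ρ b Λ η) (hmeas η₁) (hmeas η₂) (hbd η₁ D₁ hD₁) (hbd η₂ D₂ hD₂)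
  have hI : (∫ U, F₁₂ U ∂(ymSpecification ρ b Λ η)) = ∫ U, F₁ U * F₂ U ∂(ymSpecification ρ b Λ η) :=
    integral_congr_ae (ae_of_all _ hprod)
  -- assemble
  have hM : Real.log (∫ ζ, Real.exp (-b * S (glueWith Λ ζ η₁₂)) ∂(Measure.pi fun _ : ↥Λ => haarProbability G)) -
        Real.log (∫ ζ, Real.exp (-b * S (glueWith Λ ζ η₁)) ∂(Measure.pi fun _ : ↥Λ => haarProbability G)) -
        Real.log (∫ ζ, Real.exp (-b * S (glueWith Λ ζ η₂)) ∂(Measure.pi fun _ : ↥Λ => haarProbability G)) +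
        Real.log (∫ ζ, Real.exp (-b * S (glueWith Λ ζ η)) ∂(Measure.pi fun _ : ↥Λ => haarProbability G)) =
      Real.log (∫ U, F₁ U * F₂ U ∂(ymSpecification ρ b Λ η)) - Real.log (∫ U, F₁ U ∂(ymSpecification ρ b Λ η)) -
        Real.log (∫ U, F₂ U ∂(ymSpecification ρ b Λ η)) := by
    rw [← hI]
    simp only [hF₁, hF₂, hF₁₂] at hL₁ hL₂ hL₁₂ ⊢
    linarith
  rw [hM]
  calc |Real.log (∫ U, F₁ U * F₂ U ∂(ymSpecification ρ b Λ η)) - Real.log (∫ U, F₁ U ∂(ymSpecification ρ b Λ η)) -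
          Real.log (∫ U, F₂ U ∂(ymSpecification ρ b Λ η))|
      ≤ Real.exp (|b| * D₁ + |b| * D₂) * |cov[F₁, F₂; ymSpecification ρ b Λ η]| := key
    _ ≤ Real.exp (|b| * D₁ + |b| * D₂) * ε := mul_le_mul_of_nonneg_left hcov (by positivity)
    _ = Real.exp (|b| * (D₁ + D₂)) * ε := by rw [mul_add]

end Door


end BoundaryFreeEnergy

end Summit.Ventures.YMGap.RobustBall

end
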